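import Summits.AtomisticToContinuum.BoseEinsteinCondensation.Theorems.BECSwapNoCatastropheAbsTorusDefs
import Summits.AtomisticToContinuum.BoseEinsteinCondensation.Theorems.BECSwapNoCatastropheDefs
import Summits.AtomisticToContinuum.BoseEinsteinCondensation.Theorems.BECSwapNoCatastropheTorusHalfSwapOverlapAppendEmbedding
import Literature.MathematicalPhysics.QuantumManyBody.PeriodicBoseGasTagged
import HarnessLib

/-!
# Crux `TorusHalfSwapOverlap` (stmt-AtomisticToContinuum-14393), line `registered` (v7, truncation split):
# stub `stub_twoCopyTransport` (T)

Route `BECSwapNoCatastrophe` (sub-problem `BoseEinsteinCondensation`). The fixed-`n` sub-crux S (two-copy Simon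
monotone convergence for the half-swapped form `E2(½)`) is proved on `Config ((n+1)+(n+1))`; this file is the
TRANSPORT between the two-copy problem on `Config (n+1) × Config (n+1)` (absolute class `Adm0`, form `E2half w n L`)
and the `(n+1)+(n+1)`-particle problem WITHOUT Bose symmetry (class `AbsAdm`, form `absEnergyW W L`, infimum
`absGroundStateEnergyW W L`) for the transported weight `W Z = halfSwapWeight w n L (splitConfig (n+1) (n+1) Z)`,
together with the identification of that weight as the pair-profile interaction
`pairInteraction (halfSwapProfile w n) L` (pair `(p, q)` of the `2n+2` particles interacts through
`halfSwapCoeff n p q • w`).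

* §1 `splitConfig` / `Fin.append` bookkeeping (`splitConfig ∘ append = id`, `append ∘ splitConfig = id`,
  `splitConfig` is a continuous linear map);
* §2 the dictionary `Ξ ↦ Θ = Ξ ∘ Fin.append`: `Adm0 n L Θ ↔ AbsAdm _ L Ξ` and `E2half w n L Θ = absEnergyW W L Ξ`
  (chain rule `kinetic_append`, change of variables `setLIntegral_comp_append` of `AppendEmbedding`), hence the
  equality of the two infima;
* §3 the block decomposition of a pair-profile interaction of `Fin.append X Y` and the identification of the
  half-swapped weight;
* §4 the registered stub.
-/

noncomputable section

namespace Summit.AtomisticToContinuum.BoseEinsteinCondensation.Cruxes.TorusHalfSwapOverlap.TruncationSplit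

open MeasureTheory Filter Topology
open scoped ENNReal NNReal InnerProductSpace ComplexConjugate
open Literature.MathematicalPhysics.QuantumManyBody.BoseGas
open Summit.AtomisticToContinuum.BoseEinsteinCondensation.TwoCopyTorus
open Summit.AtomisticToContinuum.BoseEinsteinCondensation.AbsTorus
open Summit.AtomisticToContinuum.BoseEinsteinCondensation.Cruxes.TorusHalfSwapOverlap.Birth.AppendEmbedding

namespace TwoCopyTransport

/-! ## §1 `splitConfig` and `Fin.append` -/

section Split

variable {n₁ n₂ : ℕ}

/-- Splitting a juxtaposed configuration returns the two halves. [folklore] -/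
theorem splitConfig_append (X : Config n₁) (Y : Config n₂) : splitConfig n₁ n₂ (Fin.append X Y) = (X, Y) :=
  Prod.ext (funext fun i => by rw [splitConfig_apply_fst, Fin.append_left])
    (funext fun j => by rw [splitConfig_apply_snd, Fin.append_right])

/-- Juxtaposing the two halves of a configuration returns the configuration. [folklore] -/
theorem append_splitConfig (W : Config (n₁ + n₂)) :
    Fin.append (splitConfig n₁ n₂ W).1 (splitConfig n₁ n₂ W).2 = W := by
  rw [← splitConfig_symm_apply, MeasurableEquiv.symm_apply_apply]

/-- The splitting `splitConfig` is (the underlying map of) a continuous linear map. [folklore] -/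
theorem exists_splitCLM (n₁ n₂ : ℕ) :
    ∃ B : Config (n₁ + n₂) →L[ℝ] Config n₁ × Config n₂, ∀ W, B W = splitConfig n₁ n₂ W :=
  ⟨LinearMap.toContinuousLinearMap
    { toFun := fun W => splitConfig n₁ n₂ W
      map_add' := fun W W' => Prod.ext (funext fun i => by simp) (funext fun j => by simp)
      map_smul' := fun c W => Prod.ext (funext fun i => by simp) (funext fun j => by simp) }, fun _ => rfl⟩

/-- `(X, Y) ↦ Ξ (Fin.append X Y)` is `C¹` iff `Ξ` is (`splitConfig` and `Fin.append` are inverse continuous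
linear maps). [folklore] -/
theorem contDiff_append_iff (Ξ : Config (n₁ + n₂) → ℂ) :
    ContDiff ℝ 1 (fun Z : Config n₁ × Config n₂ => Ξ (Fin.append Z.1 Z.2)) ↔ ContDiff ℝ 1 Ξ := by
  refine ⟨fun h => ?_, contDiff_append⟩
  obtain ⟨B, hB⟩ := exists_splitCLM n₁ n₂
  have hΞ : Ξ = (fun Z : Config n₁ × Config n₂ => Ξ (Fin.append Z.1 Z.2)) ∘ B := by
    funext W
    rw [Function.comp_apply, hB, append_splitConfig]
  rw [hΞ]
  exact h.comp B.contDiff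

end Split

/-! ## §2 The dictionary `Ξ ↦ Ξ ∘ Fin.append` between the two-copy and the `(n+1)+(n+1)`-particle problems -/

variable {n : ℕ}

/-- Periodicity in both copies of `Ξ ∘ Fin.append` is torus periodicity of `Ξ`. [folklore] -/
theorem isPeriodic2_append_iff (L : ℝ) (Ξ : Config ((n + 1) + (n + 1)) → ℂ) :
    IsPeriodic2 n L (fun Z : Config2 n => Ξ (Fin.append Z.1 Z.2)) ↔ IsTorusPeriodic L Ξ := by
  constructor
  · intro h W p k
    obtain ⟨X, Y, rfl⟩ : ∃ X Y, Fin.append X Y = W := ⟨_, _, append_splitConfig W⟩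
    induction p using Fin.addCases with
    | left i =>
      rw [← append_add_single_left]
      exact (h (X, Y) i k).1
    | right j =>
      rw [← append_add_single_right]
      exact (h (X, Y) j k).2
  · intro h Z i k
    constructor
    · show Ξ (Fin.append (Z.1 + _) Z.2) = Ξ (Fin.append Z.1 Z.2)
      rw [append_add_single_left]
      exact h _ _ k
    · show Ξ (Fin.append Z.1 (Z.2 + _)) = Ξ (Fin.append Z.1 Z.2)
      rw [append_add_single_right]
      exact h _ _ k

/-- The two-copy cell norm of `Ξ ∘ Fin.append` is the cell norm of `Ξ` (change of variables). [folklore] -/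
theorem lintegral_nnnorm_append_sq (L : ℝ) (Ξ : Config ((n + 1) + (n + 1)) → ℂ) :
    ∫⁻ Z in cell2 n L, (‖Ξ (Fin.append Z.1 Z.2)‖₊ : ℝ≥0∞) ^ 2 =
      ∫⁻ W in cellN ((n + 1) + (n + 1)) L, (‖Ξ W‖₊ : ℝ≥0∞) ^ 2 :=
  setLIntegral_comp_append (n + 1) (n + 1) L fun W => (‖Ξ W‖₊ : ℝ≥0∞) ^ 2

/-- **The dictionary for the classes**: `Ξ ∘ Fin.append` is absolutely admissible on `cell²` iff `Ξ` is
absolutely admissible on the `(n+1)+(n+1)`-particle cell. [folklore] -/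
theorem adm0_append_iff (L : ℝ) (Ξ : Config ((n + 1) + (n + 1)) → ℂ) :
    Adm0 n L (fun Z : Config2 n => Ξ (Fin.append Z.1 Z.2)) ↔ AbsAdm ((n + 1) + (n + 1)) L Ξ := by
  unfold Adm0 AbsAdm
  rw [contDiff_append_iff, isPeriodic2_append_iff, lintegral_nnnorm_append_sq]

/-- **The dictionary for the forms**: the half-swapped two-copy form of `Ξ ∘ Fin.append` is the absolute form of
`Ξ` with the transported weight `halfSwapWeight ∘ splitConfig` (chain rule for the kinetic density, change of
variables on the cells). [folklore] -/
theorem E2half_append (w : ℝ → ℝ≥0∞) (L : ℝ) {Ξ : Config ((n + 1) + (n + 1)) → ℂ} (hΞ : ContDiff ℝ 1 Ξ) :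
    E2half w n L (fun Z : Config2 n => Ξ (Fin.append Z.1 Z.2)) =
      absEnergyW (fun Z : Config ((n + 1) + (n + 1)) => halfSwapWeight w n L (splitConfig (n + 1) (n + 1) Z))
        L Ξ := by
  have hdiff : Differentiable ℝ Ξ := hΞ.differentiable one_ne_zero
  have key := setLIntegral_comp_append (n + 1) (n + 1) L fun W =>
    kineticDensity Ξ W + halfSwapWeight w n L (splitConfig (n + 1) (n + 1) W) * (‖Ξ W‖₊ : ℝ≥0∞) ^ 2
  rw [E2half_eq, absEnergyW_def, ← key]
  refine lintegral_congr fun Z => ?_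
  rw [splitConfig_append, Prod.mk.eta, ← kinetic_append hdiff Z.1 Z.2]
  rfl

/-- **Equality of the infima**: the two-copy absolute infimum of `E2(½)_w` is the absolute ground-state energy
of `(n+1)+(n+1)` particles for the transported weight (the dictionary is a bijection between the classes
preserving the forms). [folklore] -/
theorem iInf_E2half_eq_absGroundStateEnergyW (w : ℝ → ℝ≥0∞) (n : ℕ) (L : ℝ) :
    (⨅ (Θ : Config2 n → ℂ) (_ : Adm0 n L Θ), E2half w n L Θ) =
      absGroundStateEnergyW
        (fun Z : Config ((n + 1) + (n + 1)) => halfSwapWeight w n L (splitConfig (n + 1) (n + 1) Z)) L := by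
  apply le_antisymm
  · rw [absGroundStateEnergyW_def]
    refine le_iInf₂ fun Ξ hΞ => ?_
    have hΘ : Adm0 n L (fun Z : Config2 n => Ξ (Fin.append Z.1 Z.2)) := (adm0_append_iff L Ξ).2 hΞ
    calc ⨅ (Θ : Config2 n → ℂ) (_ : Adm0 n L Θ), E2half w n L Θ
        ≤ E2half w n L (fun Z : Config2 n => Ξ (Fin.append Z.1 Z.2)) :=
          iInf₂_le (f := fun (Θ : Config2 n → ℂ) (_ : Adm0 n L Θ) => E2half w n L Θ) _ hΘ
      _ = _ := E2half_append w L hΞ.1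
  · refine le_iInf₂ fun Θ hΘ => ?_
    have hΘeq : (fun Z : Config2 n => Θ (splitConfig (n + 1) (n + 1) (Fin.append Z.1 Z.2))) = Θ :=
      funext fun Z => by rw [splitConfig_append, Prod.mk.eta]
    have hΞ : AbsAdm ((n + 1) + (n + 1)) L (fun W => Θ (splitConfig (n + 1) (n + 1) W)) := by
      rw [← adm0_append_iff, hΘeq]
      exact hΘ
    calc absGroundStateEnergyW _ L
        ≤ absEnergyW _ L (fun W => Θ (splitConfig (n + 1) (n + 1) W)) := absGroundStateEnergyW_le hΞ
      _ = E2half w n L (fun Z : Config2 n => Θ (splitConfig (n + 1) (n + 1) (Fin.append Z.1 Z.2))) :=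
          (E2half_append w L hΞ.1).symm
      _ = E2half w n L Θ := by rw [hΘeq]

/-! ## §3 The transported weight is the pair-profile interaction of `halfSwapProfile w n` -/

/-- Periodising a scaled profile scales the periodisation: `(c • w)^per = c • w^per`. [folklore] -/
theorem periodizedPotential_halfSwapProfile (w : ℝ → ℝ≥0∞) (n : ℕ) (p q : Fin ((n + 1) + (n + 1))) (L : ℝ)
    (x : Space) :
    periodizedPotential (halfSwapProfile w n p q) L x = halfSwapCoeff n p q * periodizedPotential w L x := by
  unfold periodizedPotential
  simp only [halfSwapProfile_apply]
  exact ENNReal.tsum_mul_left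

/-- **Splitting a pair-profile interaction of `Fin.append X Y` into blocks**: pairs inside `X`, pairs inside `Y`,
and all cross pairs (a first-block index always precedes a second-block index). [folklore] -/
theorem pairInteraction_append {n₁ n₂ : ℕ} (V : Fin (n₁ + n₂) → Fin (n₁ + n₂) → ℝ → ℝ≥0∞) (L : ℝ)
    (X : Config n₁) (Y : Config n₂) :
    pairInteraction V L (Fin.append X Y) =
      (∑ i : Fin n₁, ∑ i' : Fin n₁ with i < i',
          periodizedPotential (V (Fin.castAdd n₂ i) (Fin.castAdd n₂ i')) L (X i - X i')) +
        (∑ j : Fin n₂, ∑ j' : Fin n₂ with j < j',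
          periodizedPotential (V (Fin.natAdd n₁ j) (Fin.natAdd n₁ j')) L (Y j - Y j')) +
        ∑ i : Fin n₁, ∑ j : Fin n₂, periodizedPotential (V (Fin.castAdd n₂ i) (Fin.natAdd n₁ j)) L (X i - Y j) := by
  unfold pairInteraction
  simp only [Finset.sum_filter, Fin.sum_univ_add, Fin.append_left, Fin.append_right,
    (Fin.strictMono_castAdd n₂).lt_iff_lt, (Fin.strictMono_natAdd n₁).lt_iff_lt, castAdd_lt_natAdd,
    if_true, not_natAdd_lt_castAdd, if_false, Finset.sum_add_distrib, Finset.sum_const_zero]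
  ring

/-- **A same-copy block of the half-swapped profile matrix**: bath–bath pairs at strength `1` give the bath
interaction of the tail, tagged–bath pairs at strength `2⁻¹`. [folklore] -/
theorem sameBlock (w : ℝ → ℝ≥0∞) (L : ℝ) (X : Config (n + 1)) :
    ∑ i : Fin (n + 1), ∑ i' : Fin (n + 1) with i < i',
        (if i = 0 ∧ i' = 0 then (0 : ℝ≥0∞) else if i = 0 ∨ i' = 0 then 2⁻¹ else 1) *
          periodizedPotential w L (X i - X i') =
      periodicInteraction w L (Fin.tail X) + ∑ j : Fin n, 2⁻¹ * periodizedPotential w L (X 0 - X j.succ) := by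
  rw [Fin.sum_univ_succ, add_comm]
  congr 1
  · unfold periodicInteraction
    refine Finset.sum_congr rfl fun i _ => ?_
    rw [Finset.sum_filter, Finset.sum_filter, Fin.sum_univ_succ, if_neg (not_lt.mpr (Fin.zero_le _)), zero_add]
    refine Finset.sum_congr rfl fun j _ => ?_
    simp only [Fin.succ_lt_succ_iff, Fin.succ_ne_zero, and_self, or_self, if_false, one_mul]
    rfl
  · rw [Finset.sum_filter, Fin.sum_univ_succ, if_neg (lt_irrefl _), zero_add]
    refine Finset.sum_congr rfl fun j _ => ?_
    rw [if_pos (Fin.succ_pos j)]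
    simp only [Fin.succ_ne_zero, and_false, if_false, true_or, if_true]

/-- **The cross block of the half-swapped profile matrix**: only the (tagged, other bath) pairs interact, at
strength `2⁻¹` (`w^per` is even). [folklore] -/
theorem crossBlock (w : ℝ → ℝ≥0∞) (L : ℝ) (X Y : Config (n + 1)) :
    ∑ i : Fin (n + 1), ∑ j : Fin (n + 1),
        (if (i = 0 ∧ j ≠ 0) ∨ (i ≠ 0 ∧ j = 0) then (2⁻¹ : ℝ≥0∞) else 0) * periodizedPotential w L (X i - Y j) =
      ∑ j : Fin n, 2⁻¹ * (periodizedPotential w L (Y 0 - X j.succ) + periodizedPotential w L (X 0 - Y j.succ)) := by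
  simp only [Fin.sum_univ_succ, Fin.succ_ne_zero, ne_eq, not_true_eq_false, not_false_eq_true, and_true,
    and_false, or_false, false_or, if_true, if_false, zero_mul, zero_add, add_zero, Finset.sum_const_zero]
  rw [add_comm, ← Finset.sum_add_distrib]
  refine Finset.sum_congr rfl fun j _ => ?_
  rw [mul_add, periodizedPotential_sub_comm w L (X j.succ) (Y 0)]

/-- **The half-swapped weight is the pair-profile interaction of the juxtaposed configuration.** [folklore] -/
theorem pairInteraction_halfSwapProfile_append (w : ℝ → ℝ≥0∞) (n : ℕ) (L : ℝ) (Z : Config2 n) :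
    pairInteraction (halfSwapProfile w n) L (Fin.append Z.1 Z.2) = halfSwapWeight w n L Z := by
  rw [pairInteraction_append]
  simp only [periodizedPotential_halfSwapProfile, halfSwapCoeff_castAdd_castAdd, halfSwapCoeff_natAdd_natAdd,
    halfSwapCoeff_castAdd_natAdd]
  rw [sameBlock, sameBlock, crossBlock]
  unfold halfSwapWeight
  simp only [mul_add, Finset.sum_add_distrib]
  ring

/-- **The transported weight is the pair-profile interaction of `halfSwapProfile w n`.** [folklore] -/
theorem halfSwapWeight_splitConfig (w : ℝ → ℝ≥0∞) (n : ℕ) (L : ℝ) (W : Config ((n + 1) + (n + 1))) :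
    halfSwapWeight w n L (splitConfig (n + 1) (n + 1) W) = pairInteraction (halfSwapProfile w n) L W := by
  rw [← pairInteraction_halfSwapProfile_append, append_splitConfig]

end TwoCopyTransport

open TwoCopyTransport

/-! ## §4 The registered stub -/

/-- **Stub T (M): two-copy ↔ `(n+1)+(n+1)`-particle transport.** The two-copy absolute infimum of `E2(½)_w`
is the absolute ground-state energy of `(n+1)+(n+1)` particles for the transported weight, which is the
pair-profile interaction of `halfSwapProfile w n`. [folklore] -/
theorem stub_twoCopyTransport :
    ∀ (w : ℝ → ℝ≥0∞) (n : ℕ) (L : ℝ), 0 < L →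
      (⨅ (Θ : Config2 n → ℂ) (_ : Adm0 n L Θ), E2half w n L Θ) =
          absGroundStateEnergyW
            (fun Z : Config ((n + 1) + (n + 1)) => halfSwapWeight w n L (splitConfig (n + 1) (n + 1) Z)) L ∧
        ∀ Z : Config ((n + 1) + (n + 1)),
          halfSwapWeight w n L (splitConfig (n + 1) (n + 1) Z) = pairInteraction (halfSwapProfile w n) L Z :=
  fun w n L _ => ⟨iInf_E2half_eq_absGroundStateEnergyW w n L, halfSwapWeight_splitConfig w n L⟩

end Summit.AtomisticToContinuum.BoseEinsteinCondensation.Cruxes.TorusHalfSwapOverlap.TruncationSplit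

end
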